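import Summits.ValiantsHypothesis.ValiantsHypothesis.Theorems.SymPencilPerFourHyperplaneFlowJacobian
import Summits.ValiantsHypothesis.ValiantsHypothesis.Theorems.SymPencilPerFourHyperplaneFlowBlocks
import Summits.ValiantsHypothesis.ValiantsHypothesis.Theorems.SymPencilPerFourHyperplaneFlowDiag

/-!
# Route `SymPencil` — exact flows of `per [v; ·]` on a hyperplane seeing TWO ROWS are rigid
# (tool file for the one-row defect-2 cell `(12,4,2)` of `sdc(per_4)`, `--supports`
# stmt-ValiantsHypothesis-5674; nothing here bears on `VP ≠ VNP`)

val-width-5674-w2 g2 closed the cell `(12,4,2)` of the size-27 table MODULO the hyperplane flow rigidity (RIG)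
of `F_v(y) = per [v; y 0; y 1; y 2]` (`SymPencilSdcPerFourCellTwelveFour`, hypothesis `hrig` of
`SymPencilPerFourOneRowDefectTwoEndgame.false_of_flow_identities`): every linear `X` with
`F_v(y + t X y) = F_v(y)` for all `y ∈ ker ℓ` and all `t` admits `y ∈ ker ℓ` with `X y = 0`, `F_v(y) ≠ 0`.
This file proves (RIG)'s conclusion for every linear form `ℓ` that is non-zero on (at least) TWO of the three
rows — stub S1b of CELL-TWELVE-FOUR.md §3 — leaving exactly the one-row forms (the «R1-core», S1c, with its
per₂ / STAR exceptional planes) to the line: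

* `permanent_rows_perm`, `flow_transport`, `funLeft_symm_single` — row permutations (`LinearMap.funLeft`)
  preserve `F_v` and transport the exact flow.
* `offDiag_config` — the off-diagonal blocks in any row configuration, from
  `SymPencilPerFourHyperplaneFlowBlocks.offDiag_row0_via2` by transport.
* `exists_good_point_of_flow_rows12` — `ℓ(e₁ ⊗ t₁) = ℓ(e₂ ⊗ t₂) = 1`: all six off-diagonal blocks are
  `u_a ⊗ ℓ_b`; `X − ℓ ⊗ u` is block-diagonal and agrees with `X` on `ker ℓ`, so its first-order quantity
  vanishes on `ker ℓ`, hence everywhere (`SymPencilPerFourHyperplaneFlowBlocks.firstOrder_eq_zero_of_blockDiag`);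
  this is the Jacobian hypothesis of `SymPencilPerFourHyperplaneFlow.exists_good_point_of_flow_of_jacobian`.
* **`exists_good_point_of_flow_of_two_rows`** — the general two-row statement, by transport.

Honest label: a tool toward ONE of the open cells of the size-27 table; `27 ≤ sdc(per_4) ≤ 29` unchanged;
the crux `SdcSuperquadratic` and `VP ≠ VNP` are untouched.  No definitions, no named facts. [folklore]
-/

noncomputable section

-- single-conjunct layout: Sub = Summit, duplicated namespace component intended
set_option linter.dupNamespace false


namespace Summit.ValiantsHypothesis.ValiantsHypothesis.Theorems.SymPencilPerFourHyperplaneFlow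

open Matrix
open Summit.ValiantsHypothesis.ValiantsHypothesis.Theorems.SymPencilPerFourInnerRankRows
open Summit.ValiantsHypothesis.ValiantsHypothesis.Theorems.SymPencilPerFourRowForms
open Summit.ValiantsHypothesis.ValiantsHypothesis.Theorems.SymPencilPerFourRowNoLinearFactor
open Summit.ValiantsHypothesis.ValiantsHypothesis.Theorems.SymPencilPerFourHyperplaneFlowBlocks

variable {K : Type*} [Field K]

/-! ### Row permutations -/

/-- `F_v` is symmetric in the three rows. [folklore] -/
theorem permanent_rows_perm (v : Fin 4 → K) (y : Fin 3 → Fin 4 → K) (σ : Equiv.Perm (Fin 3)) :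
    (Matrix.of ![v, y (σ 0), y (σ 1), y (σ 2)]).permanent = (Matrix.of ![v, y 0, y 1, y 2]).permanent := by
  have h3 : ∀ a : Fin 3, a = 0 ∨ a = 1 ∨ a = 2 := by decide
  have inj := σ.injective
  rcases h3 (σ 0) with h0 | h0 | h0 <;> rcases h3 (σ 1) with h1 | h1 | h1 <;> rcases h3 (σ 2) with h2 | h2 | h2 <;>
    first
    | exact absurd (inj (h0.trans h1.symm)) (by decide)
    | exact absurd (inj (h0.trans h2.symm)) (by decide)
    | exact absurd (inj (h1.trans h2.symm)) (by decide)
    | ((rw [h0, h1, h2]) <;> (simp only [permanent_of_rows]; ring))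

/-- The exact-flow hypothesis is transported along a row permutation `π`: with `T = funLeft π⁻¹`
(`(T y) i = y (π⁻¹ i)`), the pair `(X', ℓ') = (T⁻¹ ∘ X ∘ T, ℓ ∘ T)` again has the flow on `ker ℓ'`. [folklore] -/
theorem flow_transport (v : Fin 4 → K) (X : (Fin 3 → Fin 4 → K) →ₗ[K] (Fin 3 → Fin 4 → K))
    (ℓ : (Fin 3 → Fin 4 → K) →ₗ[K] K) (π : Equiv.Perm (Fin 3))
    (h : ∀ y, ℓ y = 0 → ∀ t : K,
      (Matrix.of ![v, (y + t • X y) 0, (y + t • X y) 1, (y + t • X y) 2]).permanent =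
        (Matrix.of ![v, y 0, y 1, y 2]).permanent) :
    let T : (Fin 3 → Fin 4 → K) →ₗ[K] (Fin 3 → Fin 4 → K) := LinearMap.funLeft K (Fin 4 → K) π.symm
    let Ti : (Fin 3 → Fin 4 → K) →ₗ[K] (Fin 3 → Fin 4 → K) := LinearMap.funLeft K (Fin 4 → K) π
    ∀ y, (ℓ ∘ₗ T) y = 0 → ∀ t : K,
      (Matrix.of ![v, (y + t • (Ti ∘ₗ X ∘ₗ T) y) 0, (y + t • (Ti ∘ₗ X ∘ₗ T) y) 1,
          (y + t • (Ti ∘ₗ X ∘ₗ T) y) 2]).permanent = (Matrix.of ![v, y 0, y 1, y 2]).permanent := by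
  intro T Ti y hy t
  -- `y = Ti (T y)` and `F ∘ Ti = F`
  have hTy : ∀ w : Fin 3 → Fin 4 → K, ∀ i, Ti w i = w (π i) := fun w i => rfl
  have hT : ∀ w : Fin 3 → Fin 4 → K, ∀ i, T w i = w (π.symm i) := fun w i => rfl
  have h1 := h (T y) hy t
  -- rewrite both sides of `h1` through `Ti`
  have e : ∀ w : Fin 3 → Fin 4 → K,
      (Matrix.of ![v, w 0, w 1, w 2]).permanent = (Matrix.of ![v, (Ti w) 0, (Ti w) 1, (Ti w) 2]).permanent := by
    intro w
    rw [hTy, hTy, hTy, permanent_rows_perm]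
  rw [e (T y + t • X (T y)), e (T y)] at h1
  have hTiT : ∀ i, Ti (T y) i = y i := fun i => by rw [hTy, hT, Equiv.symm_apply_apply]
  have hsum : ∀ i, Ti (T y + t • X (T y)) i = (y + t • (Ti ∘ₗ X ∘ₗ T) y) i := fun i => by
    rw [map_add, map_smul, Pi.add_apply, Pi.smul_apply, hTiT, Pi.add_apply, Pi.smul_apply]
    rfl
  rw [hsum, hsum, hsum, hTiT, hTiT, hTiT] at h1
  exact h1

/-- Row permutations act on elementary matrices by relabelling the row. [folklore] -/
theorem funLeft_symm_single (π : Equiv.Perm (Fin 3)) (i : Fin 3) (r : Fin 4 → K) :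
    LinearMap.funLeft K (Fin 4 → K) π.symm (Pi.single i r : Fin 3 → Fin 4 → K) = Pi.single (π i) r := by
  funext j
  rw [LinearMap.funLeft_apply]
  by_cases hj : j = π i
  · subst hj; simp
  · have hj' : π.symm j ≠ i := fun h => hj (by rw [← h, Equiv.apply_symm_apply])
    rw [Pi.single_eq_of_ne hj', Pi.single_eq_of_ne hj]

/-- **Off-diagonal blocks in a row configuration.**  For a row permutation `π` (target row `π 0`, free row
`π 1`, compensating row `π 2` with `ℓ(e_{π 2} ⊗ t) = 1`), an exact flow symmetry `X` on `ker ℓ` has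
`(X (e_{π 1} ⊗ r))_{π 0} = ℓ(e_{π 1} ⊗ r) · u` and `(X (e_{π 2} ⊗ r))_{π 0} = ℓ(e_{π 2} ⊗ r) · u` with
`u = (X (e_{π 2} ⊗ t))_{π 0}`. [folklore] -/
theorem offDiag_config [CharZero K] {v : Fin 4 → K} (hv : ∀ j, v j ≠ 0)
    (X : (Fin 3 → Fin 4 → K) →ₗ[K] (Fin 3 → Fin 4 → K)) (ℓ : (Fin 3 → Fin 4 → K) →ₗ[K] K)
    (π : Equiv.Perm (Fin 3)) (t : Fin 4 → K) (ht : ℓ (Pi.single (π 2) t) = 1)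
    (h : ∀ y, ℓ y = 0 → ∀ s : K,
      (Matrix.of ![v, (y + s • X y) 0, (y + s • X y) 1, (y + s • X y) 2]).permanent =
        (Matrix.of ![v, y 0, y 1, y 2]).permanent) :
    (∀ r, X (Pi.single (π 1) r) (π 0) = ℓ (Pi.single (π 1) r) • X (Pi.single (π 2) t) (π 0)) ∧
      (∀ r, X (Pi.single (π 2) r) (π 0) = ℓ (Pi.single (π 2) r) • X (Pi.single (π 2) t) (π 0)) := by
  have hflow := flow_transport v X ℓ π h
  set T : (Fin 3 → Fin 4 → K) →ₗ[K] (Fin 3 → Fin 4 → K) := LinearMap.funLeft K (Fin 4 → K) π.symm with hT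
  set Ti : (Fin 3 → Fin 4 → K) →ₗ[K] (Fin 3 → Fin 4 → K) := LinearMap.funLeft K (Fin 4 → K) π with hTi
  -- first order for the transported pair
  have hD' : ∀ y : Fin 3 → Fin 4 → K, (ℓ ∘ₗ T) y = 0 →
      (Matrix.of ![v, (Ti ∘ₗ X ∘ₗ T) y 0, y 1, y 2]).permanent +
        (Matrix.of ![v, y 0, (Ti ∘ₗ X ∘ₗ T) y 1, y 2]).permanent +
        (Matrix.of ![v, y 0, y 1, (Ti ∘ₗ X ∘ₗ T) y 2]).permanent = 0 :=
    fun y hy => (flow_orders v y _ (hflow y hy)).1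
  have hsingle : ∀ (i : Fin 3) (r : Fin 4 → K), T (Pi.single i r) = Pi.single (π i) r := fun i r => by
    rw [hT, funLeft_symm_single]
  have happ : ∀ (i : Fin 3) (r : Fin 4 → K) (j : Fin 3),
      (Ti ∘ₗ X ∘ₗ T) (Pi.single i r) j = X (Pi.single (π i) r) (π j) := fun i r j => by
    rw [LinearMap.comp_apply, LinearMap.comp_apply, hsingle, hTi, LinearMap.funLeft_apply]
  have hℓ' : ∀ (i : Fin 3) (r : Fin 4 → K), (ℓ ∘ₗ T) (Pi.single i r) = ℓ (Pi.single (π i) r) := fun i r => by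
    rw [LinearMap.comp_apply, hsingle]
  have ht' : (ℓ ∘ₗ T) (Pi.single 2 t) = 1 := by rw [hℓ', ht]
  obtain ⟨h1, h2⟩ := offDiag_row0_via2 hv (Ti ∘ₗ X ∘ₗ T) (ℓ ∘ₗ T) t ht' hD'
  refine ⟨fun r => ?_, fun r => ?_⟩
  · have e := h1 r
    rwa [happ, happ, hℓ'] at e
  · have e := h2 r
    rwa [happ, happ, hℓ'] at e

/-- **Rigidity for a hyperplane seeing rows `1` and `2`** (`ℓ(e₁ ⊗ t₁) = ℓ(e₂ ⊗ t₂) = 1`; all `v_j ≠ 0`,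
characteristic `0`): an exact flow symmetry on `ker ℓ` has a good point. [folklore] -/
theorem exists_good_point_of_flow_rows12 [CharZero K] {v : Fin 4 → K} (hv : ∀ j, v j ≠ 0)
    (X : (Fin 3 → Fin 4 → K) →ₗ[K] (Fin 3 → Fin 4 → K)) (ℓ : (Fin 3 → Fin 4 → K) →ₗ[K] K)
    (t₁ t₂ : Fin 4 → K) (ht₁ : ℓ (Pi.single 1 t₁) = 1) (ht₂ : ℓ (Pi.single 2 t₂) = 1)
    (h : ∀ y, ℓ y = 0 → ∀ s : K,
      (Matrix.of ![v, (y + s • X y) 0, (y + s • X y) 1, (y + s • X y) 2]).permanent =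
        (Matrix.of ![v, y 0, y 1, y 2]).permanent) :
    ∃ y, ℓ y = 0 ∧ X y = 0 ∧ (Matrix.of ![v, y 0, y 1, y 2]).permanent ≠ 0 := by
  classical
  -- the three row configurations
  let π₁ : Equiv.Perm (Fin 3) := Equiv.swap 0 1
  let π₂ : Equiv.Perm (Fin 3) := Equiv.swap 0 1 * Equiv.swap 0 2
  have hπ₁ : π₁ 0 = 1 ∧ π₁ 1 = 0 ∧ π₁ 2 = 2 := by decide
  have hπ₂ : π₂ 0 = 2 ∧ π₂ 1 = 0 ∧ π₂ 2 = 1 := by decide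
  -- the three rows' off-diagonal blocks
  obtain ⟨h01, h02⟩ := offDiag_config hv X ℓ 1 t₂ (by simpa using ht₂) h
  obtain ⟨h10, h12⟩ := offDiag_config hv X ℓ π₁ t₂ (by rw [hπ₁.2.2]; exact ht₂) h
  obtain ⟨h20, h21⟩ := offDiag_config hv X ℓ π₂ t₁ (by rw [hπ₂.2.2]; exact ht₁) h
  rw [hπ₁.1, hπ₁.2.1, hπ₁.2.2] at h10
  rw [hπ₁.1, hπ₁.2.2] at h12
  rw [hπ₂.1, hπ₂.2.1, hπ₂.2.2] at h20
  rw [hπ₂.1, hπ₂.2.2] at h21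
  simp only [Equiv.Perm.one_apply] at h01 h02
  -- the rank-one correction `u`
  set u : Fin 3 → Fin 4 → K := ![X (Pi.single 2 t₂) 0, X (Pi.single 2 t₂) 1, X (Pi.single 1 t₁) 2] with hu
  have hu0 : u 0 = X (Pi.single 2 t₂) 0 := rfl
  have hu1 : u 1 = X (Pi.single 2 t₂) 1 := rfl
  have hu2 : u 2 = X (Pi.single 1 t₁) 2 := rfl
  set X' : (Fin 3 → Fin 4 → K) →ₗ[K] (Fin 3 → Fin 4 → K) := X - ℓ.smulRight u with hX'
  have hX'app : ∀ y a, X' y a = X y a - ℓ y • u a := fun y a => by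
    rw [hX', LinearMap.sub_apply, LinearMap.smulRight_apply, Pi.sub_apply, Pi.smul_apply]
  -- `X'` is block-diagonal
  have hoff : ∀ (b a : Fin 3) (r : Fin 4 → K), a ≠ b → X' (Pi.single b r) a = 0 := by
    intro b a r hab
    rw [hX'app]
    have h3 : ∀ c : Fin 3, c = 0 ∨ c = 1 ∨ c = 2 := by decide
    rcases h3 a with rfl | rfl | rfl <;> rcases h3 b with rfl | rfl | rfl
    all_goals first
      | exact absurd rfl hab
      | (rw [h01, hu0, sub_self])
      | (rw [h02, hu0, sub_self])
      | (rw [h10, hu1, sub_self])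
      | (rw [h12, hu1, sub_self])
      | (rw [h20, hu2, sub_self])
      | (rw [h21, hu2, sub_self])
  let Y : Fin 3 → (Fin 4 → K) →ₗ[K] (Fin 4 → K) := fun a =>
    (LinearMap.proj a) ∘ₗ X' ∘ₗ LinearMap.single K (fun _ : Fin 3 => Fin 4 → K) a
  have hY : ∀ a r, Y a r = X' (Pi.single a r) a := fun _ _ => rfl
  have hXd : ∀ y a, X' y a = Y a (y a) := by
    intro y a
    have hy : X' y = ∑ b, X' (Pi.single b (y b)) := by
      conv_lhs => rw [← Finset.univ_sum_single y]
      rw [map_sum]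
    rw [hy, Finset.sum_apply, Fin.sum_univ_three, hY]
    have h3 : ∀ c : Fin 3, c = 0 ∨ c = 1 ∨ c = 2 := by decide
    rcases h3 a with rfl | rfl | rfl
    · rw [hoff 1 0 _ (by decide), hoff 2 0 _ (by decide), add_zero, add_zero]
    · rw [hoff 0 1 _ (by decide), hoff 2 1 _ (by decide), zero_add, add_zero]
    · rw [hoff 0 2 _ (by decide), hoff 1 2 _ (by decide), zero_add, zero_add]
  -- first order for `X'` on `ker ℓ` (there `X' = X`), hence everywhere by the block-diagonal lemma
  have hD : ∀ y, ℓ y = 0 →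
      (Matrix.of ![v, X y 0, y 1, y 2]).permanent + (Matrix.of ![v, y 0, X y 1, y 2]).permanent +
        (Matrix.of ![v, y 0, y 1, X y 2]).permanent = 0 := fun y hy => (flow_orders v y _ (h y hy)).1
  have hDY : ∀ y : Fin 3 → Fin 4 → K, ℓ y = 0 →
      (Matrix.of ![v, Y 0 (y 0), y 1, y 2]).permanent + (Matrix.of ![v, y 0, Y 1 (y 1), y 2]).permanent +
        (Matrix.of ![v, y 0, y 1, Y 2 (y 2)]).permanent = 0 := by
    intro y hy
    have e := hD y hy
    rw [← hXd, ← hXd, ← hXd, hX'app, hX'app, hX'app, hy, zero_smul, zero_smul, zero_smul, sub_zero, sub_zero, sub_zero]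
    exact e
  have hall := firstOrder_eq_zero_of_blockDiag v Y ℓ t₁ t₂ ht₁ ht₂ hDY
  -- the Jacobian hypothesis with `w = u`
  have hJ : ∀ y : Fin 3 → Fin 4 → K,
      (Matrix.of ![v, X y 0, y 1, y 2]).permanent + (Matrix.of ![v, y 0, X y 1, y 2]).permanent +
          (Matrix.of ![v, y 0, y 1, X y 2]).permanent =
        ℓ y * ((Matrix.of ![v, u 0, y 1, y 2]).permanent + (Matrix.of ![v, y 0, u 1, y 2]).permanent +
          (Matrix.of ![v, y 0, y 1, u 2]).permanent) := by
    intro y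
    have e := hall y
    have hXy : ∀ a, X y a = Y a (y a) + ℓ y • u a := fun a => by rw [← hXd, hX'app, sub_add_cancel]
    rw [hXy, hXy, hXy, per_add_row₁, per_add_row₂, per_add_row₃, permanent_rows_smul₁, per_smul_row₂, per_smul_row₃]
    linear_combination e
  exact exists_good_point_of_flow_of_jacobian hv X ℓ u hJ h

/-- **Rigidity for a hyperplane seeing two rows.**  If `X` is an exact flow symmetry of `F_v` on `ker ℓ` and
the linear form `ℓ` is non-zero on two different rows `a ≠ b`, then there is `y ∈ ker ℓ` with `X y = 0` and
`F_v(y) ≠ 0` — the conclusion of val-width-5674-w2 g2's (RIG) (`SymPencilPerFourOneRowDefectTwoEndgame`,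
hypothesis `hrig`) for every hyperplane whose linear form is not supported on a single row.  (All `v_j ≠ 0`,
characteristic `0`.) [folklore] -/
theorem exists_good_point_of_flow_of_two_rows [CharZero K] {v : Fin 4 → K} (hv : ∀ j, v j ≠ 0)
    (X : (Fin 3 → Fin 4 → K) →ₗ[K] (Fin 3 → Fin 4 → K)) (ℓ : (Fin 3 → Fin 4 → K) →ₗ[K] K)
    (a b : Fin 3) (hab : a ≠ b) (ra rb : Fin 4 → K) (ha : ℓ (Pi.single a ra) ≠ 0) (hb : ℓ (Pi.single b rb) ≠ 0)
    (h : ∀ y, ℓ y = 0 → ∀ s : K,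
      (Matrix.of ![v, (y + s • X y) 0, (y + s • X y) 1, (y + s • X y) 2]).permanent =
        (Matrix.of ![v, y 0, y 1, y 2]).permanent) :
    ∃ y, ℓ y = 0 ∧ X y = 0 ∧ (Matrix.of ![v, y 0, y 1, y 2]).permanent ≠ 0 := by
  classical
  -- a row permutation with `π 1 = a`, `π 2 = b`
  obtain ⟨π, hπ1, hπ2⟩ : ∃ π : Equiv.Perm (Fin 3), π 1 = a ∧ π 2 = b := by
    have h3 : ∀ c : Fin 3, c = 0 ∨ c = 1 ∨ c = 2 := by decide
    rcases h3 a with rfl | rfl | rfl <;> rcases h3 b with rfl | rfl | rfl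
    all_goals first
      | exact absurd rfl hab
      | exact ⟨1, by decide, by decide⟩
      | exact ⟨Equiv.swap 0 1, by decide, by decide⟩
      | exact ⟨Equiv.swap 0 2, by decide, by decide⟩
      | exact ⟨Equiv.swap 1 2, by decide, by decide⟩
      | exact ⟨Equiv.swap 0 1 * Equiv.swap 0 2, by decide, by decide⟩
      | exact ⟨Equiv.swap 0 2 * Equiv.swap 0 1, by decide, by decide⟩
  have hflow := flow_transport v X ℓ π h
  set T : (Fin 3 → Fin 4 → K) →ₗ[K] (Fin 3 → Fin 4 → K) := LinearMap.funLeft K (Fin 4 → K) π.symm with hT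
  set Ti : (Fin 3 → Fin 4 → K) →ₗ[K] (Fin 3 → Fin 4 → K) := LinearMap.funLeft K (Fin 4 → K) π with hTi
  have hsingle : ∀ (i : Fin 3) (r : Fin 4 → K), T (Pi.single i r) = Pi.single (π i) r := fun i r => by
    rw [hT, funLeft_symm_single]
  -- scaled representatives with `ℓ' (e₁ ⊗ t₁) = ℓ' (e₂ ⊗ t₂) = 1`
  have ht₁ : (ℓ ∘ₗ T) (Pi.single 1 ((ℓ (Pi.single a ra))⁻¹ • ra)) = 1 := by
    rw [LinearMap.comp_apply, hsingle, hπ1, Pi.single_smul, map_smul, smul_eq_mul, inv_mul_cancel₀ ha]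
  have ht₂ : (ℓ ∘ₗ T) (Pi.single 2 ((ℓ (Pi.single b rb))⁻¹ • rb)) = 1 := by
    rw [LinearMap.comp_apply, hsingle, hπ2, Pi.single_smul, map_smul, smul_eq_mul, inv_mul_cancel₀ hb]
  obtain ⟨y, hy, hXy, hFy⟩ := exists_good_point_of_flow_rows12 hv (Ti ∘ₗ X ∘ₗ T) (ℓ ∘ₗ T) _ _ ht₁ ht₂ hflow
  refine ⟨T y, hy, ?_, ?_⟩
  · -- `X (T y) = T (Ti (X (T y))) = T 0`
    have e : X (T y) = T (Ti (X (T y))) := by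
      funext i
      rw [hT, LinearMap.funLeft_apply, hTi, LinearMap.funLeft_apply, Equiv.apply_symm_apply]
    rw [e]
    have e2 : Ti (X (T y)) = 0 := hXy
    rw [e2, map_zero]
  · have e : ∀ i, T y i = y (π.symm i) := fun i => rfl
    rw [e, e, e, permanent_rows_perm v y π.symm]
    exact hFy

end Summit.ValiantsHypothesis.ValiantsHypothesis.Theorems.SymPencilPerFourHyperplaneFlow

end
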